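/- Copyright: the b2b-balaban cell (near-miss cell 7), T⁴-continuum fan-out; row NE7b CRUX team (2), seat
t4-ne7b-formalise-leaf-05 (gen 35) — IR-46-2's standing division «… leaf-05 toy-instantiates» applied to leaf-02's IR-50-2
key-side record `HistReadDataLWK` once more, now with leaf-02 g32's (D) v1.1 §4 in the tree (OWNER g52 W-ne7bp1-g52-2 «leaf-01
g37's record-level K2′ stays a probe unless leaf-05 takes it into a part»), part 14 of the sanity series (`CLAIMS.log`, this
seat's INTENT 1).  Released under the licence of the surrounding project. -/
import Summits.QuantumFields.BalabanUV.T4Continuum.Support.HistoryRealiseCellsRunAssemblyWTVSSanityLWKToy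

/-!
# Sanity for the (α) assembly, part 14: ON THE KEY-SIDE RECORD `HistReadDataLWK`, MERGERS COUNT EXACTLY ONE ON INHABITED
FIBRES — the `≥ 1` half of leaf-01 g37's K2′ BY NAME from (ρ1)'s `kdMem` ((D) §4 `nonempty_choice_of_hmem`), met with part
10 §12b's `≤ 1`; and the value attained on part 11's toy (lineage `t4-ne7b-formalise-leaf-05` gen 35)

Summits-side support leaf of the T⁴-continuum cell (rung (B)+1 on a FINITE torus only; NOT infinite volume, NOT the
mass gap, NOT Clay; NOT a proof of NE7b — NOT PRINTED, NOT PROVED).  [folklore] one-liners over part 10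
(`HistReadDataLWK.kdN_le_one_of_merger` ∕ `card_kdC_le_one_of_merger`), leaf-02's FILE 1 (the record's own displays
`kdMem` ∕ `kdCN` ∕ `kdShare`) and leaf-02 g32's (D) v1.1 §4 (`HistoryRealiseCellsRunSupplyFibreKeysWTVS.nonempty_choice_of_hmem`),
ALL REUSED BY NAME; no `def`, no `structure`, nothing printed asserted, no `def … : Prop` fact, no cite-tagged hypothesis,
zero `sorry`.  The statement and the two-sided argument are leaf-01 g37's X7 INFO-1 ∕ probe K2′
(`card_kdC_eq_one_of_merger_of_nonempty`, `CLAIMS.log` l.35132; GAPS C-ne7bleaf01g37-8) — credited, here made a tree fact on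
the OWNER's word W-ne7bp1-g52-2 (l.35267) and leaf-02 g32's «your part 14 may cite `nonempty_choice_of_hmem` by name»
(INBOX l.17037).

§15 ON ANY KEY-SIDE RECORD (generic in the letters `β`), for `K ≥ K₀`, a bad key class `k`, a member `w ∈ k` and an event
`e` of the member's genealogy:
* **`HistReadDataLWK.nonempty_kdC_of_mem_fibre`** — if the class's fibre holds a term `τ`, the choice word set `kdC K w e` is
  NONEMPTY ((D) §4 at the record's `kdMem`, carriers `cellA` ∕ `physA` ∕ `jhalf`): R-OWNER-50-1's «NONEMPTY at every event»
  ON THE RECORD, births, renewals and mergers alike;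
* **`one_le_card_kdC_of_nonempty_fibre`** ∕ **`one_le_kdN_of_nonempty_fibre`** — so `1 ≤ #(kdC K w e) ≤ kdN K e` (`kdCN`):
  the member-free count letter of every event MET in an inhabited bad class is at least one;
* **`card_kdC_eq_one_of_merger_of_nonempty`** ∕ **`kdN_eq_one_of_merger_of_nonempty`** ∕
  **`exists_kdC_eq_singleton_of_merger_of_nonempty`** — at an event that is neither a birth (kind `0`) nor a renewal
  (kind `1`) part 10 §12b caps both at one (`kdShare` reads `kdN K e ≤ exp 0`), hence `#(kdC K w e) = 1`, `kdN K e = 1`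
  and the word set IS a singleton: R-OWNER-50-1's merger normalisation («mergers write nothing: ONE word, count letter
  `1`») is not only the most the record allows (part 10) but FORCED wherever (ρ1) has content (leaf-01's K2′);
* **`snd_eq_snd_of_mem_decG_of_merger_of_nonempty`** — hence ANY TWO DECORATIONS of such a member read THE SAME LETTER at
  every merger node («mergers write nothing» as a statement about content: the decoration is determined there; with
  `fst_mem_events_of_mem_decG`, a decoration's nodes are the member's events).
§16 ON THE TOY (part 11's `histReadDataLWK_toyData`, letters `Unit`, one word `{()}` per event, `kdN := 1`): the word
count is EXACTLY one at EVERY event with NO fibre hypothesis (`card_kdC_toyData_eq_one`, `nonempty_kdC_toyData`) — §15's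
value is attained, and attained on the boundary of the share check (part 11's `one_le_exp_sharpT_zero`).

HONEST.  By-name consequences of the record's OWN displays over OUR carriers; on a reading with no inhabited bad key class
(every sanity toy: `liveCV = ∅`) §15 is VACUOUS exactly as `kdMem` is, and §16 is a [decided toy]; nothing about
Bałaban's index reading (ρ1), envelopes (ρ2) or the share check's VALUES (ρ3, «FIBRE-1» closed as served) on a real
reading; (ρ1) stays an R-display; BY-NAME EFFECT ON THE WALL: NONE; NE7b NOT PRINTED ∕ NOT PROVED; spine 0∕9.  HONEST
DEPENDENCY (cell): continuum YM on T⁴ ⇐ BetaPertH ∧ nine spine estimates (0/9 proved); BetaPertH ⇐ (D1) ∧ (D4) ∧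
CAP+tail; G-an2-4 gates asym, D1 and NE2/3/4.  Unchanged here.
-/

open Finset MeasureTheory
open Literature.MathematicalPhysics.QuantumFieldTheory.Balaban1983to89
open T4PersistenceDictionary T4PersistentHistoryCount T4BankedInduction T4PrintedShapeBanking
open T4WeightBudget T4GlobalDenominator T4LiveClassFibration T4LiveStructureGas T4LiveGasToTerms T4RecordPriceSeam
open T4PartnerMultiplicity T4IndicatorShell T4MatchingAssembly T4MatchingClosure T4MatchingClosureSocket T4Continuum
open T4StabilitySocket T4BranchingRecordsGas T4TaggedShapeBanking T4CanonicalMenus T4RenewalChains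
open Literature.MathematicalPhysics.QuantumFieldTheory.Balaban1983to89.B13ScaleTransfer (Pt)
open Summit.QuantumFields.BalabanUV.T4Continuum.HistoryFlow Summit.QuantumFields.BalabanUV.T4Continuum.HistoryGen
open Summit.QuantumFields.BalabanUV.T4Continuum.HistoryGenealogyRealise
open Summit.QuantumFields.BalabanUV.T4Continuum.HistoryGenealogyInstantiate
open Summit.QuantumFields.BalabanUV.T4Continuum.HistoryAssemblyTerms
open Summit.QuantumFields.BalabanUV.T4Continuum.HistoryAssemblyMult Summit.QuantumFields.BalabanUV.T4Continuum.HistoryAssemblyMultKey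
open Summit.QuantumFields.BalabanUV.T4Continuum.HistorySocketTH
open Summit.QuantumFields.BalabanUV.T4Continuum.HistoryRealiseCellsRunApexT3bWTVS
open Summit.QuantumFields.BalabanUV.T4Continuum.HistoryRealiseCellsRunApexT3bWTVSL
open Summit.QuantumFields.BalabanUV.T4Continuum.B16HistoryIndexedRepr
open Summit.QuantumFields.BalabanUV.T4Continuum.B16HistoryIndexedTrunc
open Summit.QuantumFields.BalabanUV.T4Continuum.HistoryConstants Summit.QuantumFields.BalabanUV.T4Continuum.HistoryBankingDiscountCharge
open Summit.QuantumFields.BalabanUV.T4Continuum.HistoryBankingCreditRead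
open Summit.QuantumFields.BalabanUV.T4Continuum.HistoryBankingFibreRoom
open Summit.QuantumFields.BalabanUV.T4Continuum.HistoryBankingFibreResum (ncount ncount_born ncount_renew ncount_merge)
open Summit.QuantumFields.BalabanUV.T4Continuum.HistoryPriceNodeSum Summit.QuantumFields.BalabanUV.T4Continuum.HistoryPriceKeys
open Summit.QuantumFields.BalabanUV.T4Continuum.HistoryRealiseCellsRunSupplyWTVS
open Summit.QuantumFields.BalabanUV.T4Continuum.HistoryRealiseCellsRunSupplyKeysWTVS
open Summit.QuantumFields.BalabanUV.T4Continuum.HistoryRealiseCellsRunSupplyWTVSSanity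
open Summit.QuantumFields.BalabanUV.T4Continuum.HistoryRealiseCellsRunAssemblyWTVSData
open Summit.QuantumFields.BalabanUV.T4Continuum.HistoryRealiseCellsRunAssemblyWTVSDataL
open Summit.QuantumFields.BalabanUV.T4Continuum.HistoryRealiseCellsRunAssemblyWTVSDataLW
open Summit.QuantumFields.BalabanUV.T4Continuum.HistoryRealiseCellsRunAssemblyWTVSDataLWD
open Summit.QuantumFields.BalabanUV.T4Continuum.HistoryRealiseCellsRunAssemblyWTVSDataLWK
open Summit.QuantumFields.BalabanUV.T4Continuum.HistoryRealiseCellsRunAssemblyWTVSLW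
open Summit.QuantumFields.BalabanUV.T4Continuum.HistoryRealiseCellsRunAssemblyWTVSLWD
open Summit.QuantumFields.BalabanUV.T4Continuum.HistoryRealiseCellsRunSupplyFibreWTVS
open Summit.QuantumFields.BalabanUV.T4Continuum.HistoryRealiseCellsRunSupplyFibreKeysWTVS
open Summit.QuantumFields.BalabanUV.T4Continuum.HistoryBankingFibreDecorKeys Summit.QuantumFields.BalabanUV.T4Continuum.HistoryBankingFibreDecorSlice
open Summit.QuantumFields.BalabanUV.T4Continuum.HistoryRealiseCellsRunApexWitness
open Summit.QuantumFields.BalabanUV.T4Continuum.HistoryBankingSharpShares (ell sBsharp)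
open Summit.QuantumFields.BalabanUV.T4Continuum.HistoryBankingRoundingUnrounded (sRunr ApFlat)
open Summit.QuantumFields.BalabanUV.T4Continuum.HistoryBankingRoundingSupply (ellStar)
open Summit.QuantumFields.BalabanUV.T4Continuum.HistoryBankingVolumeWindow (uvol lamVol jvol)
open Summit.QuantumFields.BalabanUV.T4Continuum.HistoryBankingVolumeSupply (ellVol)
open Missing AveragingRT

namespace Summit.QuantumFields.BalabanUV.T4Continuum.HistoryRealiseCellsRunAssemblyWTVSSanity

noncomputable section

open B16HistoryIndexedRepr.Sanity B16HistoryIndexedRepr.SanityInput HistoryConstants.Sanity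

set_option synthInstance.maxSize 1024

/-! ## §15 On the record: nonempty words at every met event, exactly one at mergers -/

section Record

variable {F : T4Family} {G : Type*} [GaugeGroup G] [MeasurableSpace G] [HaarData G] [RegularGaugeGroup G]
  {D : FiniteEpsData F G} {C : T4PrintedShapeBanking.Consts} {O : PrintedO1s} {θv : ℝ} {rr d n : ℕ} {hn : 0 < n}
  {g₀ : ℕ → ℝ} {os : List (ULoop F)} {cΛ Lr Φ β₀ : ℝ} {p₁ η η' κ κ₂ κᵥ : ℕ} {DomK : ℕ → Type}
  {I : (K : ℕ) → HIndex (DomK K)} [DecidableEq (HIndex.Idx I)] {DomK' : ℕ → Type} {I' : (K : ℕ) → HIndex (DomK' K)}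
  {Xs : ℕ → Type} [∀ K, MeasurableSpace (Xs K)] {μ : (K : ℕ) → Measure (Xs K)} [∀ K, IsFiniteMeasure (μ K)]
  {𝒢 : (K : ℕ) → GoodClass (Xs K)} {Y : ℕ → Type} [∀ K, MeasurableSpace (Y K)] {νB : (K : ℕ) → Measure (Y K)}
  [∀ K, IsFiniteMeasure (νB K)] {𝒢' : (K : ℕ) → GoodClass (Y K)} {β : Type} [DecidableEq β]

omit [RegularGaugeGroup G] in
/-- **NONEMPTY CHOICE WORDS ON THE RECORD**: on ANY key-side record, a member `w` of a bad key class whose fibre holds a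
term `τ` has a NONEMPTY choice word set `kdC K w e` at EVERY event `e` of its genealogy — (D) §4
`nonempty_choice_of_hmem` at the record's (ρ1) display `kdMem` (the decoration `kdDec K τ w ∈ decG (kdC K w) w.2.1`
carries a letter at every node).  Births, renewals and mergers alike. [folklore] -/
theorem _root_.Summit.QuantumFields.BalabanUV.T4Continuum.HistoryRealiseCellsRunAssemblyWTVSDataLWK.HistReadDataLWK.nonempty_kdC_of_mem_fibre
    (Dd : HistReadDataLWK D C O θv rr d n hn g₀ os cΛ Lr Φ β₀ p₁ η η' κ κ₂ κᵥ β I I' Xs μ 𝒢 Y νB 𝒢') {K : ℕ} (hK : Dd.K₀ ≤ K)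
    {k : Finset ((Fin d → ℕ) × Gen PEv × Multiset (PEv × ((Fin d → ℕ) × Finset (Pt d))))}
    (hk : k ∈ badGMems (memA n F.L Dd.ℛ) jhalf (HIndex.termSet I)
      (kmemA n F.L hn (lt_of_lt_of_le (by norm_num) (two_le_L F)) Dd.ℛ) K)
    {τ : HIndex.Idx I}
    (hτ : τ ∈ fibre (kmemA n F.L hn (lt_of_lt_of_le (by norm_num) (two_le_L F)) Dd.ℛ) (HIndex.termSet I) K k)
    {w : (Fin d → ℕ) × Gen PEv × Multiset (PEv × ((Fin d → ℕ) × Finset (Pt d)))} (hw : w ∈ k) {e : PEv}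
    (he : e ∈ w.2.1.events) : (Dd.kdC K w e).Nonempty :=
  nonempty_choice_of_hmem Dd.ℛ Dd.K₀ (cellA n F.L Dd.ℛ) (physA n F.L hn (lt_of_lt_of_le (by norm_num) (two_le_L F)) Dd.ℛ)
    jhalf Dd.kdC Dd.kdDec Dd.kdMem hK hk hτ hw e he

omit [RegularGaugeGroup G] in
/-- … so on an INHABITED fibre every event of every member carries at least one choice word, [folklore] -/
theorem _root_.Summit.QuantumFields.BalabanUV.T4Continuum.HistoryRealiseCellsRunAssemblyWTVSDataLWK.HistReadDataLWK.one_le_card_kdC_of_nonempty_fibre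
    (Dd : HistReadDataLWK D C O θv rr d n hn g₀ os cΛ Lr Φ β₀ p₁ η η' κ κ₂ κᵥ β I I' Xs μ 𝒢 Y νB 𝒢') {K : ℕ} (hK : Dd.K₀ ≤ K)
    {k : Finset ((Fin d → ℕ) × Gen PEv × Multiset (PEv × ((Fin d → ℕ) × Finset (Pt d))))}
    (hk : k ∈ badGMems (memA n F.L Dd.ℛ) jhalf (HIndex.termSet I)
      (kmemA n F.L hn (lt_of_lt_of_le (by norm_num) (two_le_L F)) Dd.ℛ) K)
    (hne : (fibre (kmemA n F.L hn (lt_of_lt_of_le (by norm_num) (two_le_L F)) Dd.ℛ) (HIndex.termSet I) K k).Nonempty)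
    {w : (Fin d → ℕ) × Gen PEv × Multiset (PEv × ((Fin d → ℕ) × Finset (Pt d)))} (hw : w ∈ k) {e : PEv}
    (he : e ∈ w.2.1.events) : 1 ≤ (Dd.kdC K w e).card := by
  obtain ⟨τ, hτ⟩ := hne
  exact Finset.one_le_card.2 (Dd.nonempty_kdC_of_mem_fibre hK hk hτ hw he)

omit [RegularGaugeGroup G] in
/-- … and, by the count display `kdCN`, **the member-free count letter of every event met in an inhabited bad key class is
at least one**: `1 ≤ #(kdC K w e) ≤ kdN K e`. [folklore] -/
theorem _root_.Summit.QuantumFields.BalabanUV.T4Continuum.HistoryRealiseCellsRunAssemblyWTVSDataLWK.HistReadDataLWK.one_le_kdN_of_nonempty_fibre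
    (Dd : HistReadDataLWK D C O θv rr d n hn g₀ os cΛ Lr Φ β₀ p₁ η η' κ κ₂ κᵥ β I I' Xs μ 𝒢 Y νB 𝒢') {K : ℕ} (hK : Dd.K₀ ≤ K)
    {k : Finset ((Fin d → ℕ) × Gen PEv × Multiset (PEv × ((Fin d → ℕ) × Finset (Pt d))))}
    (hk : k ∈ badGMems (memA n F.L Dd.ℛ) jhalf (HIndex.termSet I)
      (kmemA n F.L hn (lt_of_lt_of_le (by norm_num) (two_le_L F)) Dd.ℛ) K)
    (hne : (fibre (kmemA n F.L hn (lt_of_lt_of_le (by norm_num) (two_le_L F)) Dd.ℛ) (HIndex.termSet I) K k).Nonempty)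
    {w : (Fin d → ℕ) × Gen PEv × Multiset (PEv × ((Fin d → ℕ) × Finset (Pt d)))} (hw : w ∈ k) {e : PEv}
    (he : e ∈ w.2.1.events) : 1 ≤ Dd.kdN K e :=
  (Dd.one_le_card_kdC_of_nonempty_fibre hK hk hne hw he).trans (Dd.kdCN K hK k hk w hw e he)

omit [RegularGaugeGroup G] in
/-- **MERGERS COUNT EXACTLY ONE ON INHABITED FIBRES (leaf-01 g37's K2′), the word count**: at an event of a member of an
inhabited bad key class that is neither a birth (kind `0`) nor a renewal (kind `1`), `#(kdC K w e) = 1` — `≤ 1` is part 10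
§12b (`kdShare` reads `kdN K e ≤ exp 0`, then `kdCN`), `≥ 1` is `kdMem` (an empty word set would decorate nothing).
[folklore] -/
theorem _root_.Summit.QuantumFields.BalabanUV.T4Continuum.HistoryRealiseCellsRunAssemblyWTVSDataLWK.HistReadDataLWK.card_kdC_eq_one_of_merger_of_nonempty
    (Dd : HistReadDataLWK D C O θv rr d n hn g₀ os cΛ Lr Φ β₀ p₁ η η' κ κ₂ κᵥ β I I' Xs μ 𝒢 Y νB 𝒢') {K : ℕ} (hK : Dd.K₀ ≤ K)
    {k : Finset ((Fin d → ℕ) × Gen PEv × Multiset (PEv × ((Fin d → ℕ) × Finset (Pt d))))}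
    (hk : k ∈ badGMems (memA n F.L Dd.ℛ) jhalf (HIndex.termSet I)
      (kmemA n F.L hn (lt_of_lt_of_le (by norm_num) (two_le_L F)) Dd.ℛ) K)
    (hne : (fibre (kmemA n F.L hn (lt_of_lt_of_le (by norm_num) (two_le_L F)) Dd.ℛ) (HIndex.termSet I) K k).Nonempty)
    {w : (Fin d → ℕ) × Gen PEv × Multiset (PEv × ((Fin d → ℕ) × Finset (Pt d)))} (hw : w ∈ k) {e : PEv}
    (he : e ∈ w.2.1.events) (h0 : e.kind ≠ 0) (h1 : e.kind ≠ 1) : (Dd.kdC K w e).card = 1 :=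
  le_antisymm (Dd.card_kdC_le_one_of_merger hK hk hw he h0 h1) (Dd.one_le_card_kdC_of_nonempty_fibre hK hk hne hw he)

omit [RegularGaugeGroup G] in
/-- **… and the count letter**: at such an event `kdN K e = 1` — the merger normalisation of R-OWNER-50-1 («mergers write
nothing», `N K (·,2,·) = 1`) is FORCED on the record wherever (ρ1) has content, not merely the most it allows. [folklore] -/
theorem _root_.Summit.QuantumFields.BalabanUV.T4Continuum.HistoryRealiseCellsRunAssemblyWTVSDataLWK.HistReadDataLWK.kdN_eq_one_of_merger_of_nonempty
    (Dd : HistReadDataLWK D C O θv rr d n hn g₀ os cΛ Lr Φ β₀ p₁ η η' κ κ₂ κᵥ β I I' Xs μ 𝒢 Y νB 𝒢') {K : ℕ} (hK : Dd.K₀ ≤ K)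
    {k : Finset ((Fin d → ℕ) × Gen PEv × Multiset (PEv × ((Fin d → ℕ) × Finset (Pt d))))}
    (hk : k ∈ badGMems (memA n F.L Dd.ℛ) jhalf (HIndex.termSet I)
      (kmemA n F.L hn (lt_of_lt_of_le (by norm_num) (two_le_L F)) Dd.ℛ) K)
    (hne : (fibre (kmemA n F.L hn (lt_of_lt_of_le (by norm_num) (two_le_L F)) Dd.ℛ) (HIndex.termSet I) K k).Nonempty)
    {w : (Fin d → ℕ) × Gen PEv × Multiset (PEv × ((Fin d → ℕ) × Finset (Pt d)))} (hw : w ∈ k) {e : PEv}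
    (he : e ∈ w.2.1.events) (h0 : e.kind ≠ 0) (h1 : e.kind ≠ 1) : Dd.kdN K e = 1 :=
  le_antisymm (Dd.kdN_le_one_of_merger K h0 h1) (Dd.one_le_kdN_of_nonempty_fibre hK hk hne hw he)

omit [RegularGaugeGroup G] in
/-- **… so the merger's choice word set IS a singleton**: `kdC K w e = {b}` for one letter `b`. [folklore] -/
theorem _root_.Summit.QuantumFields.BalabanUV.T4Continuum.HistoryRealiseCellsRunAssemblyWTVSDataLWK.HistReadDataLWK.exists_kdC_eq_singleton_of_merger_of_nonempty
    (Dd : HistReadDataLWK D C O θv rr d n hn g₀ os cΛ Lr Φ β₀ p₁ η η' κ κ₂ κᵥ β I I' Xs μ 𝒢 Y νB 𝒢') {K : ℕ} (hK : Dd.K₀ ≤ K)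
    {k : Finset ((Fin d → ℕ) × Gen PEv × Multiset (PEv × ((Fin d → ℕ) × Finset (Pt d))))}
    (hk : k ∈ badGMems (memA n F.L Dd.ℛ) jhalf (HIndex.termSet I)
      (kmemA n F.L hn (lt_of_lt_of_le (by norm_num) (two_le_L F)) Dd.ℛ) K)
    (hne : (fibre (kmemA n F.L hn (lt_of_lt_of_le (by norm_num) (two_le_L F)) Dd.ℛ) (HIndex.termSet I) K k).Nonempty)
    {w : (Fin d → ℕ) × Gen PEv × Multiset (PEv × ((Fin d → ℕ) × Finset (Pt d)))} (hw : w ∈ k) {e : PEv}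
    (he : e ∈ w.2.1.events) (h0 : e.kind ≠ 0) (h1 : e.kind ≠ 1) : ∃ b : β, Dd.kdC K w e = {b} :=
  Finset.card_eq_one.1 (Dd.card_kdC_eq_one_of_merger_of_nonempty hK hk hne hw he h0 h1)

omit [RegularGaugeGroup G] in
/-- **… and every letter found in it is THE letter**: `b ∈ kdC K w e → kdC K w e = {b}` at a merger of a member of an
inhabited bad key class (what a decoration `∈ decG (kdC K w) w.2.1` reads at that node is determined). [folklore] -/
theorem _root_.Summit.QuantumFields.BalabanUV.T4Continuum.HistoryRealiseCellsRunAssemblyWTVSDataLWK.HistReadDataLWK.kdC_eq_singleton_of_mem_of_merger_of_nonempty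
    (Dd : HistReadDataLWK D C O θv rr d n hn g₀ os cΛ Lr Φ β₀ p₁ η η' κ κ₂ κᵥ β I I' Xs μ 𝒢 Y νB 𝒢') {K : ℕ} (hK : Dd.K₀ ≤ K)
    {k : Finset ((Fin d → ℕ) × Gen PEv × Multiset (PEv × ((Fin d → ℕ) × Finset (Pt d))))}
    (hk : k ∈ badGMems (memA n F.L Dd.ℛ) jhalf (HIndex.termSet I)
      (kmemA n F.L hn (lt_of_lt_of_le (by norm_num) (two_le_L F)) Dd.ℛ) K)
    (hne : (fibre (kmemA n F.L hn (lt_of_lt_of_le (by norm_num) (two_le_L F)) Dd.ℛ) (HIndex.termSet I) K k).Nonempty)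
    {w : (Fin d → ℕ) × Gen PEv × Multiset (PEv × ((Fin d → ℕ) × Finset (Pt d)))} (hw : w ∈ k) {e : PEv}
    (he : e ∈ w.2.1.events) (h0 : e.kind ≠ 0) (h1 : e.kind ≠ 1) {b : β} (hb : b ∈ Dd.kdC K w e) :
    Dd.kdC K w e = {b} := by
  obtain ⟨b', hb'⟩ := Dd.exists_kdC_eq_singleton_of_merger_of_nonempty hK hk hne hw he h0 h1
  rw [hb', Finset.mem_singleton] at hb
  rw [hb', hb]

omit [RegularGaugeGroup G] in
/-- the events of a DECORATION of a member are events of the member (first components): `n ∈ G'.events → n.1 ∈ w.2.1.events`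
for `G' ∈ decG (kdC K w) w.2.1` (`gmap_fst_of_mem_decG` + `events_gmap`). [folklore] -/
theorem _root_.Summit.QuantumFields.BalabanUV.T4Continuum.HistoryRealiseCellsRunAssemblyWTVSDataLWK.HistReadDataLWK.fst_mem_events_of_mem_decG
    (Dd : HistReadDataLWK D C O θv rr d n hn g₀ os cΛ Lr Φ β₀ p₁ η η' κ κ₂ κᵥ β I I' Xs μ 𝒢 Y νB 𝒢') {K : ℕ}
    {w : (Fin d → ℕ) × Gen PEv × Multiset (PEv × ((Fin d → ℕ) × Finset (Pt d)))} {G' : Gen (PEv × β)}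
    (hG' : G' ∈ decG (Dd.kdC K w) w.2.1) {m : PEv × β} (hm : m ∈ G'.events) : m.1 ∈ w.2.1.events := by
  have h := ZoneSkeleton.events_gmap (Prod.fst : PEv × β → PEv) G'
  rw [gmap_fst_of_mem_decG (Dd.kdC K w) hG'] at h
  rw [h]
  exact Finset.mem_image_of_mem _ hm

omit [RegularGaugeGroup G] in
/-- **ALL DECORATIONS OF A MEMBER OF AN INHABITED BAD KEY CLASS READ THE SAME LETTER AT EVERY MERGER NODE** — «mergers write
nothing» (R-OWNER-50-1) as a statement about CONTENT, not only about counts: two decorations `G₁ G₂ ∈ decG (kdC K w) w.2.1`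
carry equal letters at any common node of kind ∉ {0, 1} (both letters lie in the singleton `kdC K w e`). [folklore] -/
theorem _root_.Summit.QuantumFields.BalabanUV.T4Continuum.HistoryRealiseCellsRunAssemblyWTVSDataLWK.HistReadDataLWK.snd_eq_snd_of_mem_decG_of_merger_of_nonempty
    (Dd : HistReadDataLWK D C O θv rr d n hn g₀ os cΛ Lr Φ β₀ p₁ η η' κ κ₂ κᵥ β I I' Xs μ 𝒢 Y νB 𝒢') {K : ℕ} (hK : Dd.K₀ ≤ K)
    {k : Finset ((Fin d → ℕ) × Gen PEv × Multiset (PEv × ((Fin d → ℕ) × Finset (Pt d))))}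
    (hk : k ∈ badGMems (memA n F.L Dd.ℛ) jhalf (HIndex.termSet I)
      (kmemA n F.L hn (lt_of_lt_of_le (by norm_num) (two_le_L F)) Dd.ℛ) K)
    (hne : (fibre (kmemA n F.L hn (lt_of_lt_of_le (by norm_num) (two_le_L F)) Dd.ℛ) (HIndex.termSet I) K k).Nonempty)
    {w : (Fin d → ℕ) × Gen PEv × Multiset (PEv × ((Fin d → ℕ) × Finset (Pt d)))} (hw : w ∈ k) {G₁ G₂ : Gen (PEv × β)}
    (hG₁ : G₁ ∈ decG (Dd.kdC K w) w.2.1) (hG₂ : G₂ ∈ decG (Dd.kdC K w) w.2.1) {m₁ m₂ : PEv × β} (hm₁ : m₁ ∈ G₁.events)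
    (hm₂ : m₂ ∈ G₂.events) (he : m₁.1 = m₂.1) (h0 : m₁.1.kind ≠ 0) (h1 : m₁.1.kind ≠ 1) : m₁.2 = m₂.2 := by
  have hb₁ : m₁.2 ∈ Dd.kdC K w m₁.1 := snd_mem_of_mem_decG (Dd.kdC K w) hG₁ m₁ hm₁
  have hb₂ : m₂.2 ∈ Dd.kdC K w m₁.1 := he ▸ snd_mem_of_mem_decG (Dd.kdC K w) hG₂ m₂ hm₂
  have hs := Dd.kdC_eq_singleton_of_mem_of_merger_of_nonempty hK hk hne hw (Dd.fst_mem_events_of_mem_decG hG₁ hm₁) h0 h1 hb₁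
  rw [hs, Finset.mem_singleton] at hb₂
  exact hb₂.symm

end Record

/-! ## §16 On the toy: the value attained at every event, no fibre hypothesis -/

section ToyData

variable (F : T4Family) (G : Type) [GaugeGroup G] [MeasurableSpace G] [HaarData G] [RegularGaugeGroup G]

/-- the toy's choice word set at ANY event of ANY member is the one word `{()}` — NONEMPTY with no fibre hypothesis (§15's
first conclusion, attained unconditionally) [decided toy] -/
theorem nonempty_kdC_toyData {S : ℕ} (hS : 1 ≤ S) {θv : ℝ} (hθv : 0 < θv) {cΛ Lr Φ : ℝ} (hcΛ : 0 ≤ cΛ) (hLr : 0 ≤ Lr)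
    (hΦ : 0 ≤ Φ) {β₀ : ℝ} (hβ₀ : 0 ≤ β₀) (n : ℕ) (hn : 0 < n) (K : ℕ)
    (w : (Fin 1 → ℕ) × Gen PEv × Multiset (PEv × ((Fin 1 → ℕ) × Finset (Pt 1)))) (e : PEv) :
    ((histReadDataLWK_toyData F G hS hθv hcΛ hLr hΦ hβ₀ n hn).kdC K w e).Nonempty :=
  Finset.singleton_nonempty _

/-- **ON THE TOY THE WORD COUNT IS EXACTLY ONE AT EVERY EVENT** — births, renewals and mergers, met or not: §15's merger
value `#(kdC K w e) = 1 = kdN K e` (part 11's `kdN_toyData_eq_one`) holds identically, on the boundary of the share check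
(part 11's `one_le_exp_sharpT_zero`). [decided toy] -/
theorem card_kdC_toyData_eq_one {S : ℕ} (hS : 1 ≤ S) {θv : ℝ} (hθv : 0 < θv) {cΛ Lr Φ : ℝ} (hcΛ : 0 ≤ cΛ) (hLr : 0 ≤ Lr)
    (hΦ : 0 ≤ Φ) {β₀ : ℝ} (hβ₀ : 0 ≤ β₀) (n : ℕ) (hn : 0 < n) (K : ℕ)
    (w : (Fin 1 → ℕ) × Gen PEv × Multiset (PEv × ((Fin 1 → ℕ) × Finset (Pt 1)))) (e : PEv) :
    ((histReadDataLWK_toyData F G hS hθv hcΛ hLr hΦ hβ₀ n hn).kdC K w e).card = 1 :=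
  Finset.card_singleton _

/-- … equal to the toy's count letter: the count display `kdCN` holds WITH EQUALITY on the toy at every event [decided toy] -/
theorem card_kdC_toyData_eq_kdN {S : ℕ} (hS : 1 ≤ S) {θv : ℝ} (hθv : 0 < θv) {cΛ Lr Φ : ℝ} (hcΛ : 0 ≤ cΛ) (hLr : 0 ≤ Lr)
    (hΦ : 0 ≤ Φ) {β₀ : ℝ} (hβ₀ : 0 ≤ β₀) (n : ℕ) (hn : 0 < n) (K : ℕ)
    (w : (Fin 1 → ℕ) × Gen PEv × Multiset (PEv × ((Fin 1 → ℕ) × Finset (Pt 1)))) (e : PEv) :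
    ((histReadDataLWK_toyData F G hS hθv hcΛ hLr hΦ hβ₀ n hn).kdC K w e).card =
      (histReadDataLWK_toyData F G hS hθv hcΛ hLr hΦ hβ₀ n hn).kdN K e := by
  rw [card_kdC_toyData_eq_one, kdN_toyData_eq_one]

end ToyData

end

end Summit.QuantumFields.BalabanUV.T4Continuum.HistoryRealiseCellsRunAssemblyWTVSSanity
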